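import Summits.CriticalPhenomena.PercolationContinuityZ3.Theorems.PercNearOneGluingNoHeavyLowerTailSunflowerChainEndpoint

/-!
# The CHAIN CERTIFICATE for (RES0′), one-petal inequality — part 1: the edges and diagonals of the petal polytope

(prove-1 gen 56, memo run/shared/lean/prim/prim-ineq-prove-1/FINDING-CHAIN-prove1-g56.md §1–§3.)  Model (g52 §0): parameters `τ, σ, s`, floors `0 < α₀₀ ≤ α₀₁ ≤ α₁₁ ≤ 1`,
constant `c₀ ≥ τσ`; petal `(y,k,g,h)` with `α₀₀ ≤ y ≤ k ≤ 1`, `α₀₁ ≤ g ≤ min(k,h)`, `α₁₁ ≤ h ≤ 1`;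
`G(y,k,g,h) = c₀ + τ(1−σ)((1−s)y + sk) + s(1−τ)((1−σ)g + σh)`, `g = G(floor)`.  The CHAIN EXPONENTS `λ_h, λ_k, λ_y` are defined by
three equations (each raises one more cell to the top along the chain floor → h-petal → H-hub → full petal)
  `g·(1/α₁₁)^λ_h = G(α₀₀,α₀₁,α₀₁,1)`,  `g·(1/α₀₁)^λ_k (1/α₁₁)^λ_h = G(α₀₀,1,1,1)`,  `g·(1/α₀₀)^λ_y (1/α₀₁)^λ_k (1/α₁₁)^λ_h = G(1,1,1,1)`.
**THEOREM (`chain_one_petal`).**  If the three KINK-DWARF inequalities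
  (Da) `G(α₀₁,α₀₁,α₀₁,α₁₁) ≤ g (α₀₁/α₀₀)^λ_y`, (Db) `G(α₀₀,α₁₁,α₁₁,α₁₁) ≤ g (α₁₁/α₀₁)^λ_k`, (Dc) `G(α₁₁,α₁₁,α₁₁,α₁₁) ≤ g (α₁₁/α₀₀)^λ_y (α₁₁/α₀₁)^λ_k`
hold, then EVERY petal satisfies the cell-only power certificate `G(y,k,g,h) ≤ g (y/α₀₀)^λ_y (k/α₀₁)^λ_k (h/α₁₁)^λ_h`.
PROOF: `G` is affine in each cell and the right side is a product of powers, so by the endpoint lemma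
(`affine_le_mul_rpow_of_endpoints`, convexity in the `log`-cell) the inequality reduces to the 14 vertices of the petal polytope; after
raising `g` to `min(k,h)` (unpriced, `G` monotone) these are: floor, h-petal, H-hub, full (the chain: equalities), the three kink dwarfs
(hypotheses), `(α₀₁,α₀₁,α₀₁,1)` (from (Da)), and `(α₀₀,1,α₁₁,α₁₁)`, `(1,1,α₁₁,α₁₁)` (two-petal identities needing exactly `c₀ ≥ τσ`).
The companion file `…ChainCertificateAllN` tensorises this into (RES0′) for every number of petals from the three CELL budgets
`∏y ≤ α₀₀^(n−1)`, `∏k ≤ α₀₁^(n−1)`, `∏h ≤ α₁₁^(n−1)` alone; numerically the hypotheses hold on ≈ 78 % of the parameter cube (memo §2). [this work]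
-/

namespace Summit.CriticalPhenomena.PercolationContinuityZ3.Theorems.SunflowerPartition.SafeCalc.LinkedCurrency

section Chain

variable {τ σ s α00 α01 α11 c0 g ly lk lh : ℝ}

/- The standing hypotheses of the chain certificate (parameters, the three chain equations, the three kink-dwarf inequalities),
bundled so that every lemma of the vertex reduction takes the same argument. -/
variable (hH : 0 < τ ∧ τ < 1 ∧ 0 ≤ σ ∧ σ < 1 ∧ 0 ≤ s ∧ s ≤ 1 ∧ 0 < α00 ∧ α00 ≤ α01 ∧ α01 ≤ α11 ∧ α11 ≤ 1 ∧ τ * σ ≤ c0 ∧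
      g = (c0 + τ * (1 - σ) * ((1 - s) * α00 + s * α01) + s * (1 - τ) * ((1 - σ) * α01 + σ * α11)) ∧
      (c0 + τ * (1 - σ) * ((1 - s) * α00 + s * α01) + s * (1 - τ) * ((1 - σ) * α01 + σ * 1)) = g * (1 / α11) ^ lh ∧
      (c0 + τ * (1 - σ) * ((1 - s) * α00 + s * 1) + s * (1 - τ) * ((1 - σ) * 1 + σ * 1)) = g * (1 / α01) ^ lk * (1 / α11) ^ lh ∧
      (c0 + τ * (1 - σ) * ((1 - s) * 1 + s * 1) + s * (1 - τ) * ((1 - σ) * 1 + σ * 1)) = g * (1 / α00) ^ ly * (1 / α01) ^ lk * (1 / α11) ^ lh ∧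
      (c0 + τ * (1 - σ) * ((1 - s) * α01 + s * α01) + s * (1 - τ) * ((1 - σ) * α01 + σ * α11)) ≤ g * (α01 / α00) ^ ly ∧
      (c0 + τ * (1 - σ) * ((1 - s) * α00 + s * α11) + s * (1 - τ) * ((1 - σ) * α11 + σ * α11)) ≤ g * (α11 / α01) ^ lk ∧
      (c0 + τ * (1 - σ) * ((1 - s) * α11 + s * α11) + s * (1 - τ) * ((1 - σ) * α11 + σ * α11)) ≤ g * (α11 / α00) ^ ly * (α11 / α01) ^ lk)

include hH

/-- `g > 0` and the trivial power factors `(α/α)^λ = 1`. -/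
theorem chain_basic : 0 < g ∧ (α00 / α00) ^ ly = 1 ∧ (α01 / α01) ^ lk = 1 ∧ (α11 / α11) ^ lh = 1 := by
  obtain ⟨hτ0, hτ1, hσ0, hσ1, hs0, hs1, hα00, h01, h11, -, hc0, hg, -, -, -, -, -, -⟩ := id hH
  have hα01 : 0 < α01 := lt_of_lt_of_le hα00 h01
  have hα11 : 0 < α11 := lt_of_lt_of_le hα01 h11
  refine ⟨?_, ?_, ?_, ?_⟩
  · rw [hg]
    have h1 : 0 < τ * (1 - σ) * ((1 - s) * α00 + s * α01) := by
      apply mul_pos (mul_pos hτ0 (by linarith))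
      nlinarith [mul_nonneg hs0 (sub_nonneg.2 h01)]
    have h2 : 0 ≤ s * (1 - τ) * ((1 - σ) * α01 + σ * α11) :=
      mul_nonneg (mul_nonneg hs0 (by linarith)) (by nlinarith [mul_nonneg hσ0 hα11.le])
    nlinarith [mul_nonneg hτ0.le hσ0]
  · rw [div_self (ne_of_gt hα00), Real.one_rpow]
  · rw [div_self (ne_of_gt hα01), Real.one_rpow]
  · rw [div_self (ne_of_gt hα11), Real.one_rpow]

/-- Edge `(α₀₀,α₀₁,α₀₁,h)`, `h ∈ [α₁₁,1]` (endpoints: floor; h-petal = first chain equation). -/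
theorem chain_hedge0 : ∀ h : ℝ, α11 ≤ h → h ≤ 1 → (c0 + τ * (1 - σ) * ((1 - s) * α00 + s * α01) + s * (1 - τ) * ((1 - σ) * α01 + σ * h)) ≤ g * (α00 / α00) ^ ly * (α01 / α01) ^ lk * (h / α11) ^ lh := by
  have hb := chain_basic hH
  obtain ⟨hτ0, hτ1, hσ0, hσ1, hs0, hs1, hα00, h01, h11, hα1, hc0, hg, Eh, -, -, -, -, -⟩ := id hH
  obtain ⟨hg0, u0, u1, u2⟩ := hb
  have hα01 : 0 < α01 := lt_of_lt_of_le hα00 h01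
  have hα11 : 0 < α11 := lt_of_lt_of_le hα01 h11
  have h1σ : 0 ≤ 1 - σ := sub_nonneg.2 hσ1.le
  have h1s : 0 ≤ 1 - s := sub_nonneg.2 hs1
  have h1τ : 0 ≤ 1 - τ := sub_nonneg.2 hτ1.le
  have hc0' : 0 ≤ c0 := le_trans (mul_nonneg hτ0.le hσ0) hc0
  intro h hh0 hh1
  have hA : 0 ≤ (c0 + τ * (1 - σ) * ((1 - s) * α00 + s * α01) + s * (1 - τ) * ((1 - σ) * α01)) :=
    add_nonneg (add_nonneg hc0' (mul_nonneg (mul_nonneg hτ0.le h1σ) (add_nonneg (mul_nonneg h1s hα00.le) (mul_nonneg hs0 hα01.le)))) (mul_nonneg (mul_nonneg hs0 h1τ) (mul_nonneg h1σ hα01.le))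
  have hB : 0 ≤ (τ * (1 - σ) * (0) + s * (1 - τ) * (σ)) :=
    add_nonneg (mul_nonneg (mul_nonneg hτ0.le h1σ) (le_refl 0)) (mul_nonneg (mul_nonneg hs0 h1τ) (hσ0))
  have e0 : (c0 + τ * (1 - σ) * ((1 - s) * α00 + s * α01) + s * (1 - τ) * ((1 - σ) * α01)) + (τ * (1 - σ) * (0) + s * (1 - τ) * (σ)) * α11 ≤ g * (α00 / α00) ^ ly * (α01 / α01) ^ lk * (α11 / α11) ^ lh := by
    have h0 : (c0 + τ * (1 - σ) * ((1 - s) * α00 + s * α01) + s * (1 - τ) * ((1 - σ) * α01 + σ * α11)) ≤ g * (α00 / α00) ^ ly * (α01 / α01) ^ lk * (α11 / α11) ^ lh :=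
      by
        rw [u0, u1, u2, ← hg]; exact le_of_eq (by ring)
    calc (c0 + τ * (1 - σ) * ((1 - s) * α00 + s * α01) + s * (1 - τ) * ((1 - σ) * α01)) + (τ * (1 - σ) * (0) + s * (1 - τ) * (σ)) * α11 = (c0 + τ * (1 - σ) * ((1 - s) * α00 + s * α01) + s * (1 - τ) * ((1 - σ) * α01 + σ * α11)) := by ring
      _ ≤ g * (α00 / α00) ^ ly * (α01 / α01) ^ lk * (α11 / α11) ^ lh := h0
      _ = g * (α00 / α00) ^ ly * (α01 / α01) ^ lk * (α11 / α11) ^ lh := by ring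
  have e1 : (c0 + τ * (1 - σ) * ((1 - s) * α00 + s * α01) + s * (1 - τ) * ((1 - σ) * α01)) + (τ * (1 - σ) * (0) + s * (1 - τ) * (σ)) * 1 ≤ g * (α00 / α00) ^ ly * (α01 / α01) ^ lk * (1 / α11) ^ lh := by
    have h1 : (c0 + τ * (1 - σ) * ((1 - s) * α00 + s * α01) + s * (1 - τ) * ((1 - σ) * α01 + σ * 1)) ≤ g * (α00 / α00) ^ ly * (α01 / α01) ^ lk * (1 / α11) ^ lh :=
      by
        rw [u0, u1, Eh]; exact le_of_eq (by ring)
    calc (c0 + τ * (1 - σ) * ((1 - s) * α00 + s * α01) + s * (1 - τ) * ((1 - σ) * α01)) + (τ * (1 - σ) * (0) + s * (1 - τ) * (σ)) * 1 = (c0 + τ * (1 - σ) * ((1 - s) * α00 + s * α01) + s * (1 - τ) * ((1 - σ) * α01 + σ * 1)) := by ring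
      _ ≤ g * (α00 / α00) ^ ly * (α01 / α01) ^ lk * (1 / α11) ^ lh := h1
      _ = g * (α00 / α00) ^ ly * (α01 / α01) ^ lk * (1 / α11) ^ lh := by ring
  have key : (c0 + τ * (1 - σ) * ((1 - s) * α00 + s * α01) + s * (1 - τ) * ((1 - σ) * α01)) + (τ * (1 - σ) * (0) + s * (1 - τ) * (σ)) * h ≤ g * (α00 / α00) ^ ly * (α01 / α01) ^ lk * (h / α11) ^ lh :=
    affine_le_mul_rpow_of_endpoints₁ hA hB hα11 hα11 hh0 hh1 e0 e1
  calc (c0 + τ * (1 - σ) * ((1 - s) * α00 + s * α01) + s * (1 - τ) * ((1 - σ) * α01 + σ * h)) = (c0 + τ * (1 - σ) * ((1 - s) * α00 + s * α01) + s * (1 - τ) * ((1 - σ) * α01)) + (τ * (1 - σ) * (0) + s * (1 - τ) * (σ)) * h := by ring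
    _ ≤ g * (α00 / α00) ^ ly * (α01 / α01) ^ lk * (h / α11) ^ lh := key
    _ = g * (α00 / α00) ^ ly * (α01 / α01) ^ lk * (h / α11) ^ lh := by ring

/-- Edge `(α₀₁,α₀₁,α₀₁,h)`, `h ∈ [α₁₁,1]` (endpoints: the cheap-y dwarf (Da); `(α₀₁,α₀₁,α₀₁,1)` from (Da) and the h-petal). -/
theorem chain_hedge1 : ∀ h : ℝ, α11 ≤ h → h ≤ 1 → (c0 + τ * (1 - σ) * ((1 - s) * α01 + s * α01) + s * (1 - τ) * ((1 - σ) * α01 + σ * h)) ≤ g * (α01 / α00) ^ ly * (α01 / α01) ^ lk * (h / α11) ^ lh := by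
  have hb := chain_basic hH
  obtain ⟨hτ0, hτ1, hσ0, hσ1, hs0, hs1, hα00, h01, h11, hα1, hc0, hg, Eh, -, -, Da, -, -⟩ := id hH
  obtain ⟨hg0, u0, u1, u2⟩ := hb
  have hα01 : 0 < α01 := lt_of_lt_of_le hα00 h01
  have hα11 : 0 < α11 := lt_of_lt_of_le hα01 h11
  have h1σ : 0 ≤ 1 - σ := sub_nonneg.2 hσ1.le
  have h1s : 0 ≤ 1 - s := sub_nonneg.2 hs1
  have h1τ : 0 ≤ 1 - τ := sub_nonneg.2 hτ1.le
  have hc0' : 0 ≤ c0 := le_trans (mul_nonneg hτ0.le hσ0) hc0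
  intro h hh0 hh1
  have hA : 0 ≤ (c0 + τ * (1 - σ) * ((1 - s) * α01 + s * α01) + s * (1 - τ) * ((1 - σ) * α01)) :=
    add_nonneg (add_nonneg hc0' (mul_nonneg (mul_nonneg hτ0.le h1σ) (add_nonneg (mul_nonneg h1s hα01.le) (mul_nonneg hs0 hα01.le)))) (mul_nonneg (mul_nonneg hs0 h1τ) (mul_nonneg h1σ hα01.le))
  have hB : 0 ≤ (τ * (1 - σ) * (0) + s * (1 - τ) * (σ)) :=
    add_nonneg (mul_nonneg (mul_nonneg hτ0.le h1σ) (le_refl 0)) (mul_nonneg (mul_nonneg hs0 h1τ) (hσ0))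
  have e0 : (c0 + τ * (1 - σ) * ((1 - s) * α01 + s * α01) + s * (1 - τ) * ((1 - σ) * α01)) + (τ * (1 - σ) * (0) + s * (1 - τ) * (σ)) * α11 ≤ g * (α01 / α00) ^ ly * (α01 / α01) ^ lk * (α11 / α11) ^ lh := by
    have h0 : (c0 + τ * (1 - σ) * ((1 - s) * α01 + s * α01) + s * (1 - τ) * ((1 - σ) * α01 + σ * α11)) ≤ g * (α01 / α00) ^ ly * (α01 / α01) ^ lk * (α11 / α11) ^ lh :=
      by
        rw [u1, u2]
        calc (c0 + τ * (1 - σ) * ((1 - s) * α01 + s * α01) + s * (1 - τ) * ((1 - σ) * α01 + σ * α11)) ≤ g * (α01 / α00) ^ ly := Da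
          _ = _ := by ring
    calc (c0 + τ * (1 - σ) * ((1 - s) * α01 + s * α01) + s * (1 - τ) * ((1 - σ) * α01)) + (τ * (1 - σ) * (0) + s * (1 - τ) * (σ)) * α11 = (c0 + τ * (1 - σ) * ((1 - s) * α01 + s * α01) + s * (1 - τ) * ((1 - σ) * α01 + σ * α11)) := by ring
      _ ≤ g * (α01 / α00) ^ ly * (α01 / α01) ^ lk * (α11 / α11) ^ lh := h0
      _ = g * (α01 / α00) ^ ly * (α01 / α01) ^ lk * (α11 / α11) ^ lh := by ring
  have e1 : (c0 + τ * (1 - σ) * ((1 - s) * α01 + s * α01) + s * (1 - τ) * ((1 - σ) * α01)) + (τ * (1 - σ) * (0) + s * (1 - τ) * (σ)) * 1 ≤ g * (α01 / α00) ^ ly * (α01 / α01) ^ lk * (1 / α11) ^ lh := by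
    have h1 : (c0 + τ * (1 - σ) * ((1 - s) * α01 + s * α01) + s * (1 - τ) * ((1 - σ) * α01 + σ * 1)) ≤ g * (α01 / α00) ^ ly * (α01 / α01) ^ lk * (1 / α11) ^ lh :=
      by
        rw [u1]
        have dDa : (c0 + τ * (1 - σ) * ((1 - s) * α01 + s * α01) + s * (1 - τ) * ((1 - σ) * α01 + σ * α11)) = g + τ * (1 - σ) * (1 - s) * (α01 - α00) := by rw [hg]; ring
        have dhp : (c0 + τ * (1 - σ) * ((1 - s) * α00 + s * α01) + s * (1 - τ) * ((1 - σ) * α01 + σ * 1)) = g + s * (1 - τ) * σ * (1 - α11) := by rw [hg]; ring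
        have dDah : (c0 + τ * (1 - σ) * ((1 - s) * α01 + s * α01) + s * (1 - τ) * ((1 - σ) * α01 + σ * 1)) = g + τ * (1 - σ) * (1 - s) * (α01 - α00) + s * (1 - τ) * σ * (1 - α11) := by rw [hg]; ring
        obtain ⟨P1, hP1⟩ : ∃ P : ℝ, P = τ * (1 - σ) * (1 - s) * (α01 - α00) := ⟨_, rfl⟩
        obtain ⟨P2, hP2⟩ : ∃ P : ℝ, P = s * (1 - τ) * σ * (1 - α11) := ⟨_, rfl⟩
        have hP1n : 0 ≤ P1 := by rw [hP1]; exact mul_nonneg (mul_nonneg (mul_nonneg hτ0.le h1σ) h1s) (sub_nonneg.2 h01)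
        have hP2n : 0 ≤ P2 := by rw [hP2]; exact mul_nonneg (mul_nonneg (mul_nonneg hs0 h1τ) hσ0) (sub_nonneg.2 hα1)
        rw [← hP1] at dDa dDah; rw [← hP2] at dhp dDah
        have Da' := Da; have Eh' := Eh
        rw [dDa] at Da'; rw [dhp] at Eh'; rw [dDah]
        obtain ⟨X, hX⟩ : ∃ v : ℝ, v = (α01 / α00) ^ ly := ⟨_, rfl⟩
        obtain ⟨R, hR⟩ : ∃ v : ℝ, v = (1 / α11) ^ lh := ⟨_, rfl⟩
        rw [← hX] at Da' ⊢; rw [← hR] at Eh' ⊢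
        have e1 : (g + P1) * (g + P2) ≤ (g * X) * (g + P2) := mul_le_mul_of_nonneg_right Da' (add_nonneg hg0.le hP2n)
        have key : g * (g + P1 + P2) ≤ g * (g * X * 1 * R) :=
          calc g * (g + P1 + P2) = (g + P1) * (g + P2) - P1 * P2 := by ring
            _ ≤ (g + P1) * (g + P2) := sub_le_self _ (mul_nonneg hP1n hP2n)
            _ ≤ (g * X) * (g + P2) := e1
            _ = (g * X) * (g * R) := by rw [Eh']
            _ = g * (g * X * 1 * R) := by ring
        exact le_of_mul_le_mul_left key hg0
    calc (c0 + τ * (1 - σ) * ((1 - s) * α01 + s * α01) + s * (1 - τ) * ((1 - σ) * α01)) + (τ * (1 - σ) * (0) + s * (1 - τ) * (σ)) * 1 = (c0 + τ * (1 - σ) * ((1 - s) * α01 + s * α01) + s * (1 - τ) * ((1 - σ) * α01 + σ * 1)) := by ring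
      _ ≤ g * (α01 / α00) ^ ly * (α01 / α01) ^ lk * (1 / α11) ^ lh := h1
      _ = g * (α01 / α00) ^ ly * (α01 / α01) ^ lk * (1 / α11) ^ lh := by ring
  have key : (c0 + τ * (1 - σ) * ((1 - s) * α01 + s * α01) + s * (1 - τ) * ((1 - σ) * α01)) + (τ * (1 - σ) * (0) + s * (1 - τ) * (σ)) * h ≤ g * (α01 / α00) ^ ly * (α01 / α01) ^ lk * (h / α11) ^ lh :=
    affine_le_mul_rpow_of_endpoints₁ hA hB hα11 hα11 hh0 hh1 e0 e1
  calc (c0 + τ * (1 - σ) * ((1 - s) * α01 + s * α01) + s * (1 - τ) * ((1 - σ) * α01 + σ * h)) = (c0 + τ * (1 - σ) * ((1 - s) * α01 + s * α01) + s * (1 - τ) * ((1 - σ) * α01)) + (τ * (1 - σ) * (0) + s * (1 - τ) * (σ)) * h := by ring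
    _ ≤ g * (α01 / α00) ^ ly * (α01 / α01) ^ lk * (h / α11) ^ lh := key
    _ = g * (α01 / α00) ^ ly * (α01 / α01) ^ lk * (h / α11) ^ lh := by ring

/-- Diagonal `(α₀₀,h,h,h)`, `h ∈ [α₁₁,1]` (endpoints: the leverage dwarf (Db); the H-hub = second chain equation). -/
theorem chain_diag0 : ∀ h : ℝ, α11 ≤ h → h ≤ 1 → (c0 + τ * (1 - σ) * ((1 - s) * α00 + s * h) + s * (1 - τ) * ((1 - σ) * h + σ * h)) ≤ g * (α00 / α00) ^ ly * (h / α01) ^ lk * (h / α11) ^ lh := by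
  have hb := chain_basic hH
  obtain ⟨hτ0, hτ1, hσ0, hσ1, hs0, hs1, hα00, h01, h11, hα1, hc0, hg, -, EH, -, -, Db, -⟩ := id hH
  obtain ⟨hg0, u0, u1, u2⟩ := hb
  have hα01 : 0 < α01 := lt_of_lt_of_le hα00 h01
  have hα11 : 0 < α11 := lt_of_lt_of_le hα01 h11
  have h1σ : 0 ≤ 1 - σ := sub_nonneg.2 hσ1.le
  have h1s : 0 ≤ 1 - s := sub_nonneg.2 hs1
  have h1τ : 0 ≤ 1 - τ := sub_nonneg.2 hτ1.le
  have hc0' : 0 ≤ c0 := le_trans (mul_nonneg hτ0.le hσ0) hc0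
  intro h hh0 hh1
  have hA : 0 ≤ (c0 + τ * (1 - σ) * ((1 - s) * α00) + s * (1 - τ) * (0)) :=
    add_nonneg (add_nonneg hc0' (mul_nonneg (mul_nonneg hτ0.le h1σ) (mul_nonneg h1s hα00.le))) (mul_nonneg (mul_nonneg hs0 h1τ) (le_refl 0))
  have hB : 0 ≤ (τ * (1 - σ) * (s) + s * (1 - τ) * ((1 - σ) + σ)) :=
    add_nonneg (mul_nonneg (mul_nonneg hτ0.le h1σ) (hs0)) (mul_nonneg (mul_nonneg hs0 h1τ) ((by rw [show (1 - σ) + σ = (1:ℝ) by ring]; exact zero_le_one)))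
  have e0 : (c0 + τ * (1 - σ) * ((1 - s) * α00) + s * (1 - τ) * (0)) + (τ * (1 - σ) * (s) + s * (1 - τ) * ((1 - σ) + σ)) * α11 ≤ g * (α00 / α00) ^ ly * (α11 / α01) ^ lk * (α11 / α11) ^ lh := by
    have h0 : (c0 + τ * (1 - σ) * ((1 - s) * α00 + s * α11) + s * (1 - τ) * ((1 - σ) * α11 + σ * α11)) ≤ g * (α00 / α00) ^ ly * (α11 / α01) ^ lk * (α11 / α11) ^ lh :=
      by
        rw [u0, u2]
        calc (c0 + τ * (1 - σ) * ((1 - s) * α00 + s * α11) + s * (1 - τ) * ((1 - σ) * α11 + σ * α11)) ≤ g * (α11 / α01) ^ lk := Db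
          _ = _ := by ring
    calc (c0 + τ * (1 - σ) * ((1 - s) * α00) + s * (1 - τ) * (0)) + (τ * (1 - σ) * (s) + s * (1 - τ) * ((1 - σ) + σ)) * α11 = (c0 + τ * (1 - σ) * ((1 - s) * α00 + s * α11) + s * (1 - τ) * ((1 - σ) * α11 + σ * α11)) := by ring
      _ ≤ g * (α00 / α00) ^ ly * (α11 / α01) ^ lk * (α11 / α11) ^ lh := h0
      _ = g * (α00 / α00) ^ ly * (α11 / α01) ^ lk * (α11 / α11) ^ lh := by ring
  have e1 : (c0 + τ * (1 - σ) * ((1 - s) * α00) + s * (1 - τ) * (0)) + (τ * (1 - σ) * (s) + s * (1 - τ) * ((1 - σ) + σ)) * 1 ≤ g * (α00 / α00) ^ ly * (1 / α01) ^ lk * (1 / α11) ^ lh := by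
    have h1 : (c0 + τ * (1 - σ) * ((1 - s) * α00 + s * 1) + s * (1 - τ) * ((1 - σ) * 1 + σ * 1)) ≤ g * (α00 / α00) ^ ly * (1 / α01) ^ lk * (1 / α11) ^ lh :=
      by
        rw [u0, EH]; exact le_of_eq (by ring)
    calc (c0 + τ * (1 - σ) * ((1 - s) * α00) + s * (1 - τ) * (0)) + (τ * (1 - σ) * (s) + s * (1 - τ) * ((1 - σ) + σ)) * 1 = (c0 + τ * (1 - σ) * ((1 - s) * α00 + s * 1) + s * (1 - τ) * ((1 - σ) * 1 + σ * 1)) := by ring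
      _ ≤ g * (α00 / α00) ^ ly * (1 / α01) ^ lk * (1 / α11) ^ lh := h1
      _ = g * (α00 / α00) ^ ly * (1 / α01) ^ lk * (1 / α11) ^ lh := by ring
  have key : (c0 + τ * (1 - σ) * ((1 - s) * α00) + s * (1 - τ) * (0)) + (τ * (1 - σ) * (s) + s * (1 - τ) * ((1 - σ) + σ)) * h ≤ g * (α00 / α00) ^ ly * (h / α01) ^ lk * (h / α11) ^ lh :=
    affine_le_mul_rpow_of_endpoints₂ hA hB hα01 hα11 hα11 hh0 hh1 e0 e1
  calc (c0 + τ * (1 - σ) * ((1 - s) * α00 + s * h) + s * (1 - τ) * ((1 - σ) * h + σ * h)) = (c0 + τ * (1 - σ) * ((1 - s) * α00) + s * (1 - τ) * (0)) + (τ * (1 - σ) * (s) + s * (1 - τ) * ((1 - σ) + σ)) * h := by ring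
    _ ≤ g * (α00 / α00) ^ ly * (h / α01) ^ lk * (h / α11) ^ lh := key
    _ = g * (α00 / α00) ^ ly * (h / α01) ^ lk * (h / α11) ^ lh := by ring

/-- Diagonal `(h,h,h,h)`, `h ∈ [α₁₁,1]` (endpoints: the dwarf (Dc); the full petal = third chain equation). -/
theorem chain_diag1 : ∀ h : ℝ, α11 ≤ h → h ≤ 1 → (c0 + τ * (1 - σ) * ((1 - s) * h + s * h) + s * (1 - τ) * ((1 - σ) * h + σ * h)) ≤ g * (h / α00) ^ ly * (h / α01) ^ lk * (h / α11) ^ lh := by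
  have hb := chain_basic hH
  obtain ⟨hτ0, hτ1, hσ0, hσ1, hs0, hs1, hα00, h01, h11, hα1, hc0, hg, -, -, Ef, -, -, Dc⟩ := id hH
  obtain ⟨hg0, u0, u1, u2⟩ := hb
  have hα01 : 0 < α01 := lt_of_lt_of_le hα00 h01
  have hα11 : 0 < α11 := lt_of_lt_of_le hα01 h11
  have h1σ : 0 ≤ 1 - σ := sub_nonneg.2 hσ1.le
  have h1s : 0 ≤ 1 - s := sub_nonneg.2 hs1
  have h1τ : 0 ≤ 1 - τ := sub_nonneg.2 hτ1.le
  have hc0' : 0 ≤ c0 := le_trans (mul_nonneg hτ0.le hσ0) hc0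
  intro h hh0 hh1
  have hA : 0 ≤ (c0 + τ * (1 - σ) * (0) + s * (1 - τ) * (0)) :=
    add_nonneg (add_nonneg hc0' (mul_nonneg (mul_nonneg hτ0.le h1σ) (le_refl 0))) (mul_nonneg (mul_nonneg hs0 h1τ) (le_refl 0))
  have hB : 0 ≤ (τ * (1 - σ) * ((1 - s) + s) + s * (1 - τ) * ((1 - σ) + σ)) :=
    add_nonneg (mul_nonneg (mul_nonneg hτ0.le h1σ) ((by rw [show (1 - s) + s = (1:ℝ) by ring]; exact zero_le_one))) (mul_nonneg (mul_nonneg hs0 h1τ) ((by rw [show (1 - σ) + σ = (1:ℝ) by ring]; exact zero_le_one)))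
  have e0 : (c0 + τ * (1 - σ) * (0) + s * (1 - τ) * (0)) + (τ * (1 - σ) * ((1 - s) + s) + s * (1 - τ) * ((1 - σ) + σ)) * α11 ≤ g * (α11 / α00) ^ ly * (α11 / α01) ^ lk * (α11 / α11) ^ lh := by
    have h0 : (c0 + τ * (1 - σ) * ((1 - s) * α11 + s * α11) + s * (1 - τ) * ((1 - σ) * α11 + σ * α11)) ≤ g * (α11 / α00) ^ ly * (α11 / α01) ^ lk * (α11 / α11) ^ lh :=
      by
        rw [u2]
        calc (c0 + τ * (1 - σ) * ((1 - s) * α11 + s * α11) + s * (1 - τ) * ((1 - σ) * α11 + σ * α11)) ≤ g * (α11 / α00) ^ ly * (α11 / α01) ^ lk := Dc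
          _ = _ := by ring
    calc (c0 + τ * (1 - σ) * (0) + s * (1 - τ) * (0)) + (τ * (1 - σ) * ((1 - s) + s) + s * (1 - τ) * ((1 - σ) + σ)) * α11 = (c0 + τ * (1 - σ) * ((1 - s) * α11 + s * α11) + s * (1 - τ) * ((1 - σ) * α11 + σ * α11)) := by ring
      _ ≤ g * (α11 / α00) ^ ly * (α11 / α01) ^ lk * (α11 / α11) ^ lh := h0
      _ = g * (α11 / α00) ^ ly * (α11 / α01) ^ lk * (α11 / α11) ^ lh := by ring
  have e1 : (c0 + τ * (1 - σ) * (0) + s * (1 - τ) * (0)) + (τ * (1 - σ) * ((1 - s) + s) + s * (1 - τ) * ((1 - σ) + σ)) * 1 ≤ g * (1 / α00) ^ ly * (1 / α01) ^ lk * (1 / α11) ^ lh := by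
    have h1 : (c0 + τ * (1 - σ) * ((1 - s) * 1 + s * 1) + s * (1 - τ) * ((1 - σ) * 1 + σ * 1)) ≤ g * (1 / α00) ^ ly * (1 / α01) ^ lk * (1 / α11) ^ lh :=
      le_of_eq Ef
    calc (c0 + τ * (1 - σ) * (0) + s * (1 - τ) * (0)) + (τ * (1 - σ) * ((1 - s) + s) + s * (1 - τ) * ((1 - σ) + σ)) * 1 = (c0 + τ * (1 - σ) * ((1 - s) * 1 + s * 1) + s * (1 - τ) * ((1 - σ) * 1 + σ * 1)) := by ring
      _ ≤ g * (1 / α00) ^ ly * (1 / α01) ^ lk * (1 / α11) ^ lh := h1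
      _ = g * (1 / α00) ^ ly * (1 / α01) ^ lk * (1 / α11) ^ lh := by ring
  have key : (c0 + τ * (1 - σ) * (0) + s * (1 - τ) * (0)) + (τ * (1 - σ) * ((1 - s) + s) + s * (1 - τ) * ((1 - σ) + σ)) * h ≤ g * (h / α00) ^ ly * (h / α01) ^ lk * (h / α11) ^ lh :=
    affine_le_mul_rpow_of_endpoints₃ hA hB hα00 hα01 hα11 hα11 hh0 hh1 e0 e1
  calc (c0 + τ * (1 - σ) * ((1 - s) * h + s * h) + s * (1 - τ) * ((1 - σ) * h + σ * h)) = (c0 + τ * (1 - σ) * (0) + s * (1 - τ) * (0)) + (τ * (1 - σ) * ((1 - s) + s) + s * (1 - τ) * ((1 - σ) + σ)) * h := by ring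
    _ ≤ g * (h / α00) ^ ly * (h / α01) ^ lk * (h / α11) ^ lh := key
    _ = g * (h / α00) ^ ly * (h / α01) ^ lk * (h / α11) ^ lh := by ring

/-- Edge `(α₀₀,k,α₁₁,α₁₁)`, `k ∈ [α₁₁,1]` (endpoints: (Db); `(α₀₀,1,α₁₁,α₁₁)`, which needs `c₀ ≥ τσ`). -/
theorem chain_kedge0 : ∀ k : ℝ, α11 ≤ k → k ≤ 1 → (c0 + τ * (1 - σ) * ((1 - s) * α00 + s * k) + s * (1 - τ) * ((1 - σ) * α11 + σ * α11)) ≤ g * (α00 / α00) ^ ly * (k / α01) ^ lk * (α11 / α11) ^ lh := by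
  have hb := chain_basic hH
  obtain ⟨hτ0, hτ1, hσ0, hσ1, hs0, hs1, hα00, h01, h11, hα1, hc0, hg, Eh, EH, -, -, Db, -⟩ := id hH
  obtain ⟨hg0, u0, u1, u2⟩ := hb
  have hα01 : 0 < α01 := lt_of_lt_of_le hα00 h01
  have hα11 : 0 < α11 := lt_of_lt_of_le hα01 h11
  have h1σ : 0 ≤ 1 - σ := sub_nonneg.2 hσ1.le
  have h1s : 0 ≤ 1 - s := sub_nonneg.2 hs1
  have h1τ : 0 ≤ 1 - τ := sub_nonneg.2 hτ1.le
  have hc0' : 0 ≤ c0 := le_trans (mul_nonneg hτ0.le hσ0) hc0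
  intro k hk0 hk1
  have hA : 0 ≤ (c0 + τ * (1 - σ) * ((1 - s) * α00) + s * (1 - τ) * ((1 - σ) * α11 + σ * α11)) :=
    add_nonneg (add_nonneg hc0' (mul_nonneg (mul_nonneg hτ0.le h1σ) (mul_nonneg h1s hα00.le))) (mul_nonneg (mul_nonneg hs0 h1τ) (add_nonneg (mul_nonneg h1σ hα11.le) (mul_nonneg hσ0 hα11.le)))
  have hB : 0 ≤ (τ * (1 - σ) * (s) + s * (1 - τ) * (0)) :=
    add_nonneg (mul_nonneg (mul_nonneg hτ0.le h1σ) (hs0)) (mul_nonneg (mul_nonneg hs0 h1τ) (le_refl 0))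
  have e0 : (c0 + τ * (1 - σ) * ((1 - s) * α00) + s * (1 - τ) * ((1 - σ) * α11 + σ * α11)) + (τ * (1 - σ) * (s) + s * (1 - τ) * (0)) * α11 ≤ g * (α00 / α00) ^ ly * (α11 / α11) ^ lh * (α11 / α01) ^ lk := by
    have h0 : (c0 + τ * (1 - σ) * ((1 - s) * α00 + s * α11) + s * (1 - τ) * ((1 - σ) * α11 + σ * α11)) ≤ g * (α00 / α00) ^ ly * (α11 / α01) ^ lk * (α11 / α11) ^ lh :=
      by
        rw [u0, u2]
        calc (c0 + τ * (1 - σ) * ((1 - s) * α00 + s * α11) + s * (1 - τ) * ((1 - σ) * α11 + σ * α11)) ≤ g * (α11 / α01) ^ lk := Db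
          _ = _ := by ring
    calc (c0 + τ * (1 - σ) * ((1 - s) * α00) + s * (1 - τ) * ((1 - σ) * α11 + σ * α11)) + (τ * (1 - σ) * (s) + s * (1 - τ) * (0)) * α11 = (c0 + τ * (1 - σ) * ((1 - s) * α00 + s * α11) + s * (1 - τ) * ((1 - σ) * α11 + σ * α11)) := by ring
      _ ≤ g * (α00 / α00) ^ ly * (α11 / α01) ^ lk * (α11 / α11) ^ lh := h0
      _ = g * (α00 / α00) ^ ly * (α11 / α11) ^ lh * (α11 / α01) ^ lk := by ring
  have e1 : (c0 + τ * (1 - σ) * ((1 - s) * α00) + s * (1 - τ) * ((1 - σ) * α11 + σ * α11)) + (τ * (1 - σ) * (s) + s * (1 - τ) * (0)) * 1 ≤ g * (α00 / α00) ^ ly * (α11 / α11) ^ lh * (1 / α01) ^ lk := by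
    have h1 : (c0 + τ * (1 - σ) * ((1 - s) * α00 + s * 1) + s * (1 - τ) * ((1 - σ) * α11 + σ * α11)) ≤ g * (α00 / α00) ^ ly * (1 / α01) ^ lk * (α11 / α11) ^ lh :=
      by
        rw [u0, u2]
        obtain ⟨Q, hQ⟩ : ∃ Q : ℝ, Q = s * (1 - τ) * (1 - α11) := ⟨_, rfl⟩
        obtain ⟨B4, hB4⟩ : ∃ B : ℝ, B = (1 - σ) * g - σ * (τ * (1 - σ) * s * (1 - α01) + s * (1 - τ) * (1 - σ) * (α11 - α01)) := ⟨_, rfl⟩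
        have fac : g * (c0 + τ * (1 - σ) * ((1 - s) * α00 + s * 1) + s * (1 - τ) * ((1 - σ) * 1 + σ * 1)) - (c0 + τ * (1 - σ) * ((1 - s) * α00 + s * 1) + s * (1 - τ) * ((1 - σ) * α11 + σ * α11)) * (c0 + τ * (1 - σ) * ((1 - s) * α00 + s * α01) + s * (1 - τ) * ((1 - σ) * α01 + σ * 1)) = Q * B4 := by rw [hQ, hB4, hg]; ring
        have hQ0 : 0 ≤ Q := by rw [hQ]; exact mul_nonneg (mul_nonneg hs0 h1τ) (sub_nonneg.2 hα1)
        have hB4n : 0 ≤ B4 := by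
          have idB : B4 = (1 - σ) * ((c0 - τ * σ) + α01 * s + α00 * τ * (1 - σ) * (1 - s) + σ * τ * (1 - s)) := by rw [hB4, hg]; ring
          rw [idB]
          apply mul_nonneg h1σ
          have t1 : 0 ≤ α00 * τ * (1 - σ) * (1 - s) := mul_nonneg (mul_nonneg (mul_nonneg hα00.le hτ0.le) h1σ) h1s
          have t2 : 0 ≤ σ * τ * (1 - s) := mul_nonneg (mul_nonneg hσ0 hτ0.le) h1s
          have t3 : 0 ≤ α01 * s := mul_nonneg hα01.le hs0
          exact add_nonneg (add_nonneg (add_nonneg (sub_nonneg.2 hc0) t3) t1) t2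
        have dhp : (c0 + τ * (1 - σ) * ((1 - s) * α00 + s * α01) + s * (1 - τ) * ((1 - σ) * α01 + σ * 1)) = g + s * (1 - τ) * σ * (1 - α11) := by rw [hg]; ring
        have hpp : 0 < (c0 + τ * (1 - σ) * ((1 - s) * α00 + s * α01) + s * (1 - τ) * ((1 - σ) * α01 + σ * 1)) := by
          rw [dhp]; exact add_pos_of_pos_of_nonneg hg0 (mul_nonneg (mul_nonneg (mul_nonneg hs0 h1τ) hσ0) (sub_nonneg.2 hα1))
        obtain ⟨VH, hVH⟩ : ∃ v : ℝ, v = (c0 + τ * (1 - σ) * ((1 - s) * α00 + s * 1) + s * (1 - τ) * ((1 - σ) * 1 + σ * 1)) := ⟨_, rfl⟩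
        obtain ⟨Vp, hVp⟩ : ∃ v : ℝ, v = (c0 + τ * (1 - σ) * ((1 - s) * α00 + s * α01) + s * (1 - τ) * ((1 - σ) * α01 + σ * 1)) := ⟨_, rfl⟩
        obtain ⟨V4, hV4⟩ : ∃ v : ℝ, v = (c0 + τ * (1 - σ) * ((1 - s) * α00 + s * 1) + s * (1 - τ) * ((1 - σ) * α11 + σ * α11)) := ⟨_, rfl⟩
        obtain ⟨K, hK⟩ : ∃ v : ℝ, v = (1 / α01) ^ lk := ⟨_, rfl⟩
        obtain ⟨R, hR⟩ : ∃ v : ℝ, v = (1 / α11) ^ lh := ⟨_, rfl⟩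
        have EH' := EH; have Eh' := Eh
        rw [← hVH, ← hK, ← hR] at EH'; rw [← hVp, ← hR] at Eh'; rw [← hVH, ← hVp, ← hV4] at fac; rw [← hVp] at hpp; rw [← hV4, ← hK]
        have main : V4 * Vp ≤ (g * 1 * K * 1) * Vp :=
          calc V4 * Vp = g * VH - Q * B4 := by rw [← fac]; ring
            _ ≤ g * VH := sub_le_self _ (mul_nonneg hQ0 hB4n)
            _ = g * (g * K * R) := by rw [EH']
            _ = (g * 1 * K * 1) * (g * R) := by ring
            _ = (g * 1 * K * 1) * Vp := by rw [Eh']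
        exact le_of_mul_le_mul_right main hpp
    calc (c0 + τ * (1 - σ) * ((1 - s) * α00) + s * (1 - τ) * ((1 - σ) * α11 + σ * α11)) + (τ * (1 - σ) * (s) + s * (1 - τ) * (0)) * 1 = (c0 + τ * (1 - σ) * ((1 - s) * α00 + s * 1) + s * (1 - τ) * ((1 - σ) * α11 + σ * α11)) := by ring
      _ ≤ g * (α00 / α00) ^ ly * (1 / α01) ^ lk * (α11 / α11) ^ lh := h1
      _ = g * (α00 / α00) ^ ly * (α11 / α11) ^ lh * (1 / α01) ^ lk := by ring
  have key : (c0 + τ * (1 - σ) * ((1 - s) * α00) + s * (1 - τ) * ((1 - σ) * α11 + σ * α11)) + (τ * (1 - σ) * (s) + s * (1 - τ) * (0)) * k ≤ g * (α00 / α00) ^ ly * (α11 / α11) ^ lh * (k / α01) ^ lk :=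
    affine_le_mul_rpow_of_endpoints₁ hA hB hα01 hα11 hk0 hk1 e0 e1
  calc (c0 + τ * (1 - σ) * ((1 - s) * α00 + s * k) + s * (1 - τ) * ((1 - σ) * α11 + σ * α11)) = (c0 + τ * (1 - σ) * ((1 - s) * α00) + s * (1 - τ) * ((1 - σ) * α11 + σ * α11)) + (τ * (1 - σ) * (s) + s * (1 - τ) * (0)) * k := by ring
    _ ≤ g * (α00 / α00) ^ ly * (α11 / α11) ^ lh * (k / α01) ^ lk := key
    _ = g * (α00 / α00) ^ ly * (k / α01) ^ lk * (α11 / α11) ^ lh := by ring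

/-- Edge `(k,k,α₁₁,α₁₁)`, `k ∈ [α₁₁,1]` (endpoints: (Dc); `(1,1,α₁₁,α₁₁)`, which needs `c₀ ≥ τσ`). -/
theorem chain_kedge1 : ∀ k : ℝ, α11 ≤ k → k ≤ 1 → (c0 + τ * (1 - σ) * ((1 - s) * k + s * k) + s * (1 - τ) * ((1 - σ) * α11 + σ * α11)) ≤ g * (k / α00) ^ ly * (k / α01) ^ lk * (α11 / α11) ^ lh := by
  have hb := chain_basic hH
  obtain ⟨hτ0, hτ1, hσ0, hσ1, hs0, hs1, hα00, h01, h11, hα1, hc0, hg, Eh, -, Ef, -, -, Dc⟩ := id hH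
  obtain ⟨hg0, u0, u1, u2⟩ := hb
  have hα01 : 0 < α01 := lt_of_lt_of_le hα00 h01
  have hα11 : 0 < α11 := lt_of_lt_of_le hα01 h11
  have h1σ : 0 ≤ 1 - σ := sub_nonneg.2 hσ1.le
  have h1s : 0 ≤ 1 - s := sub_nonneg.2 hs1
  have h1τ : 0 ≤ 1 - τ := sub_nonneg.2 hτ1.le
  have hc0' : 0 ≤ c0 := le_trans (mul_nonneg hτ0.le hσ0) hc0
  intro k hk0 hk1
  have hA : 0 ≤ (c0 + τ * (1 - σ) * (0) + s * (1 - τ) * ((1 - σ) * α11 + σ * α11)) :=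
    add_nonneg (add_nonneg hc0' (mul_nonneg (mul_nonneg hτ0.le h1σ) (le_refl 0))) (mul_nonneg (mul_nonneg hs0 h1τ) (add_nonneg (mul_nonneg h1σ hα11.le) (mul_nonneg hσ0 hα11.le)))
  have hB : 0 ≤ (τ * (1 - σ) * ((1 - s) + s) + s * (1 - τ) * (0)) :=
    add_nonneg (mul_nonneg (mul_nonneg hτ0.le h1σ) ((by rw [show (1 - s) + s = (1:ℝ) by ring]; exact zero_le_one))) (mul_nonneg (mul_nonneg hs0 h1τ) (le_refl 0))
  have e0 : (c0 + τ * (1 - σ) * (0) + s * (1 - τ) * ((1 - σ) * α11 + σ * α11)) + (τ * (1 - σ) * ((1 - s) + s) + s * (1 - τ) * (0)) * α11 ≤ g * (α11 / α11) ^ lh * (α11 / α00) ^ ly * (α11 / α01) ^ lk := by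
    have h0 : (c0 + τ * (1 - σ) * ((1 - s) * α11 + s * α11) + s * (1 - τ) * ((1 - σ) * α11 + σ * α11)) ≤ g * (α11 / α00) ^ ly * (α11 / α01) ^ lk * (α11 / α11) ^ lh :=
      by
        rw [u2]
        calc (c0 + τ * (1 - σ) * ((1 - s) * α11 + s * α11) + s * (1 - τ) * ((1 - σ) * α11 + σ * α11)) ≤ g * (α11 / α00) ^ ly * (α11 / α01) ^ lk := Dc
          _ = _ := by ring
    calc (c0 + τ * (1 - σ) * (0) + s * (1 - τ) * ((1 - σ) * α11 + σ * α11)) + (τ * (1 - σ) * ((1 - s) + s) + s * (1 - τ) * (0)) * α11 = (c0 + τ * (1 - σ) * ((1 - s) * α11 + s * α11) + s * (1 - τ) * ((1 - σ) * α11 + σ * α11)) := by ring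
      _ ≤ g * (α11 / α00) ^ ly * (α11 / α01) ^ lk * (α11 / α11) ^ lh := h0
      _ = g * (α11 / α11) ^ lh * (α11 / α00) ^ ly * (α11 / α01) ^ lk := by ring
  have e1 : (c0 + τ * (1 - σ) * (0) + s * (1 - τ) * ((1 - σ) * α11 + σ * α11)) + (τ * (1 - σ) * ((1 - s) + s) + s * (1 - τ) * (0)) * 1 ≤ g * (α11 / α11) ^ lh * (1 / α00) ^ ly * (1 / α01) ^ lk := by
    have h1 : (c0 + τ * (1 - σ) * ((1 - s) * 1 + s * 1) + s * (1 - τ) * ((1 - σ) * α11 + σ * α11)) ≤ g * (1 / α00) ^ ly * (1 / α01) ^ lk * (α11 / α11) ^ lh :=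
      by
        rw [u2]
        obtain ⟨Q, hQ⟩ : ∃ Q : ℝ, Q = s * (1 - τ) * (1 - α11) := ⟨_, rfl⟩
        obtain ⟨B3, hB3⟩ : ∃ B : ℝ, B = (1 - σ) * g - σ * (τ * (1 - σ) * ((1 - s) * (1 - α00) + s * (1 - α01)) + s * (1 - τ) * (1 - σ) * (α11 - α01)) := ⟨_, rfl⟩
        have fac : g * (c0 + τ * (1 - σ) * ((1 - s) * 1 + s * 1) + s * (1 - τ) * ((1 - σ) * 1 + σ * 1)) - (c0 + τ * (1 - σ) * ((1 - s) * 1 + s * 1) + s * (1 - τ) * ((1 - σ) * α11 + σ * α11)) * (c0 + τ * (1 - σ) * ((1 - s) * α00 + s * α01) + s * (1 - τ) * ((1 - σ) * α01 + σ * 1)) = Q * B3 := by rw [hQ, hB3, hg]; ring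
        have hQ0 : 0 ≤ Q := by rw [hQ]; exact mul_nonneg (mul_nonneg hs0 h1τ) (sub_nonneg.2 hα1)
        have hB3n : 0 ≤ B3 := by
          have idB : B3 = (1 - σ) * ((c0 - τ * σ) + α01 * s + α00 * τ * (1 - s)) := by rw [hB3, hg]; ring
          rw [idB]
          apply mul_nonneg h1σ
          have t1 : 0 ≤ α00 * τ * (1 - s) := mul_nonneg (mul_nonneg hα00.le hτ0.le) h1s
          have t3 : 0 ≤ α01 * s := mul_nonneg hα01.le hs0
          exact add_nonneg (add_nonneg (sub_nonneg.2 hc0) t3) t1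
        have dhp : (c0 + τ * (1 - σ) * ((1 - s) * α00 + s * α01) + s * (1 - τ) * ((1 - σ) * α01 + σ * 1)) = g + s * (1 - τ) * σ * (1 - α11) := by rw [hg]; ring
        have hpp : 0 < (c0 + τ * (1 - σ) * ((1 - s) * α00 + s * α01) + s * (1 - τ) * ((1 - σ) * α01 + σ * 1)) := by
          rw [dhp]; exact add_pos_of_pos_of_nonneg hg0 (mul_nonneg (mul_nonneg (mul_nonneg hs0 h1τ) hσ0) (sub_nonneg.2 hα1))
        obtain ⟨VF, hVF⟩ : ∃ v : ℝ, v = (c0 + τ * (1 - σ) * ((1 - s) * 1 + s * 1) + s * (1 - τ) * ((1 - σ) * 1 + σ * 1)) := ⟨_, rfl⟩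
        obtain ⟨Vp, hVp⟩ : ∃ v : ℝ, v = (c0 + τ * (1 - σ) * ((1 - s) * α00 + s * α01) + s * (1 - τ) * ((1 - σ) * α01 + σ * 1)) := ⟨_, rfl⟩
        obtain ⟨V3, hV3⟩ : ∃ v : ℝ, v = (c0 + τ * (1 - σ) * ((1 - s) * 1 + s * 1) + s * (1 - τ) * ((1 - σ) * α11 + σ * α11)) := ⟨_, rfl⟩
        obtain ⟨U, hU⟩ : ∃ v : ℝ, v = (1 / α00) ^ ly := ⟨_, rfl⟩
        obtain ⟨K, hK⟩ : ∃ v : ℝ, v = (1 / α01) ^ lk := ⟨_, rfl⟩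
        obtain ⟨R, hR⟩ : ∃ v : ℝ, v = (1 / α11) ^ lh := ⟨_, rfl⟩
        have Ef' := Ef; have Eh' := Eh
        rw [← hVF, ← hU, ← hK, ← hR] at Ef'; rw [← hVp, ← hR] at Eh'; rw [← hVF, ← hVp, ← hV3] at fac; rw [← hVp] at hpp; rw [← hV3, ← hU, ← hK]
        have main : V3 * Vp ≤ (g * U * K * 1) * Vp :=
          calc V3 * Vp = g * VF - Q * B3 := by rw [← fac]; ring
            _ ≤ g * VF := sub_le_self _ (mul_nonneg hQ0 hB3n)
            _ = g * (g * U * K * R) := by rw [Ef']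
            _ = (g * U * K * 1) * (g * R) := by ring
            _ = (g * U * K * 1) * Vp := by rw [Eh']
        exact le_of_mul_le_mul_right main hpp
    calc (c0 + τ * (1 - σ) * (0) + s * (1 - τ) * ((1 - σ) * α11 + σ * α11)) + (τ * (1 - σ) * ((1 - s) + s) + s * (1 - τ) * (0)) * 1 = (c0 + τ * (1 - σ) * ((1 - s) * 1 + s * 1) + s * (1 - τ) * ((1 - σ) * α11 + σ * α11)) := by ring
      _ ≤ g * (1 / α00) ^ ly * (1 / α01) ^ lk * (α11 / α11) ^ lh := h1
      _ = g * (α11 / α11) ^ lh * (1 / α00) ^ ly * (1 / α01) ^ lk := by ring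
  have key : (c0 + τ * (1 - σ) * (0) + s * (1 - τ) * ((1 - σ) * α11 + σ * α11)) + (τ * (1 - σ) * ((1 - s) + s) + s * (1 - τ) * (0)) * k ≤ g * (α11 / α11) ^ lh * (k / α00) ^ ly * (k / α01) ^ lk :=
    affine_le_mul_rpow_of_endpoints₂ hA hB hα00 hα01 hα11 hk0 hk1 e0 e1
  calc (c0 + τ * (1 - σ) * ((1 - s) * k + s * k) + s * (1 - τ) * ((1 - σ) * α11 + σ * α11)) = (c0 + τ * (1 - σ) * (0) + s * (1 - τ) * ((1 - σ) * α11 + σ * α11)) + (τ * (1 - σ) * ((1 - s) + s) + s * (1 - τ) * (0)) * k := by ring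
    _ ≤ g * (α11 / α11) ^ lh * (k / α00) ^ ly * (k / α01) ^ lk := key
    _ = g * (k / α00) ^ ly * (k / α01) ^ lk * (α11 / α11) ^ lh := by ring


end Chain

end Summit.CriticalPhenomena.PercolationContinuityZ3.Theorems.SunflowerPartition.SafeCalc.LinkedCurrency
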